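import Literature.MathematicalPhysics.QuantumFieldTheory.Balaban1983to89.B13OpsYPencilTransport

/-!
# `Balaban1983to89.B13OpsYPencilAveraging` — T. Bałaban, *Propagators for lattice gauge theories in a background field*, Commun. Math. Phys. **99** (1985)
# 389–434 [Balaban1985BackgroundPropagators], (3.12)–(3.13) p. 392, (3.14) p. 393 (the covariant bond averaging `Q(U)` and its adjoint `Q*(U)`), (3.19), (3.21) pp. 393–394
# (the block averaging `Q′(U)`: «(Q′_j(U)λ)(y) = Σ_{x∈B^j(y)} L^{−jd} R(U(Γ^{(j)}_{y,x})) λ(x)»), (3.24) p. 394 (`Q′*`), p. 396 («U′ = exp iηA′»), Thm 3.4 p. 400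
# («the operators … extend to configurations U′U … as analytic functions of A′»), (3.108) p. 416; [Balaban1988RG2Cluster] (2.5) p. 12, p. 15: THM 3.4's
# SENTENCE FOR THE FOUR AVERAGING LETTERS `Q(U)`, `Q*(U)`, `Q′(U)`, `Q′*(U)` AT NODE 00's OPERATORS `Node00.QY ∕ QsY ∕ QpY ∕ QpsY` (`Node00/OpsYDeltaA`) WITH
# THE GENUINE TRANSPORTER LETTERS OF RECORD `parBY ∕ parSY` (`Node00/OpsYTransport`), ALONG pv27's GROUP PENCIL `A′ ↦ prodCfg U₀ η A′`: every coordinate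
# holomorphic in `A′` on every chart ball, bounded in terms of `Kη^{D}` with `D` the transport length ON THE KERNEL's SUPPORT, identified with NODE 00's letter.

statement-level complex analysis ([folklore]) AT NODE 00's `rfl`-level definitions (`qT qpT QY QsY QpY QpsY`), over `B13OpsYPencilTransport` (the taxicab
transporters along the pencil: holomorphic, `≤ Kη^{tdist}`) and `B13TransportedLiftLetters` (the coordinate reader, here with a SUPPORT-RESTRICTED transporter
bound); kernel-checked; THEOREMS ONLY (no `def`, no `structure`, no instance, no notation); NOTHING of NODE 00's ∕ pv27's is modified; nothing here is a claim
about the Yang–Mills mass gap; no node is discharged; count-neutral.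

WHY THIS FILE (cell `pub-ymgap`, HUMAN RULING D-0062 ∕ D-0149, Track A node N10 = [B13]; seat `pub-ymgap-dag-n10-c` g14, INTENT-6; census v16 item 1).  With
modules 69 (differential letters), 70–71 (holonomy, Hessian) and 72 (transporters) the seat's reading of NODE 00's LOCAL operator layer along the pencil lacks
only the four AVERAGING letters.  Their transporter assignments `qT i parB U ι b = parB U (corner of ι) (b.src)` and `qpT i parS U s z = parS U (corner of s) z`
transport along CONTOURS, so the uniform transporter bound of `B13TransportedLiftLetters.norm_coord_trLift_le` would be `Kη` to the torus DIAMETER; the right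
bound is `Kη` to the transport length WHERE THE KERNEL IS NON-ZERO (inside one block: print's `x ∈ B^j(y)`).  §1 states the reader with that
support-restricted bound (generic), §2 the transporter facts for `qT ∕ qpT` at `parBY ∕ parSY` along the pencil, §3 the twelve coordinate statements.

WHAT THIS FILE PROVES (all `theorem`s; `𝔸` NODE 00's complete normed `ℂ`-algebra with `‖1‖ = 1`).
* §1 (generic) `norm_coord_trLift_le_of_support` — as `B13TransportedLiftLetters.norm_coord_trLift_le` but the transporter bounds `Kf ∕ Kb` are asked only where
  `M(y,x) ≠ 0`.
* §2 `qT_parBY` ∕ `qpT_parSY` (the assignments at the letters of record are taxicab transporters, `rfl`), `differentiableOn_qT_prodCfg ∕ _inv_`,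
  `differentiableOn_qpT_prodCfg ∕ _inv_`, `norm_qT_prodCfg_le ∕ _inv_` (`≤ Kη^{tdist}`), `norm_qpT_prodCfg_le ∕ _inv_`.
* §3 ★ for each of `QY` (3.12), `QsY` (3.13) (inverted transporters), `QpY` (3.19)∕(3.21), `QpsY` (3.24): `differentiableOn_coord_<letter>_prodCfg` (every
  coordinate `A′ ↦ M(y,x)·φ_k(R(T(A′)(y,x)) e_l)` holomorphic on every chart ball), `norm_coord_<letter>_prodCfg_le` (`≤ |M(y,x)|·‖φ_k‖·(Kη^D·‖e_l‖·Kη^D)` given a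
  SUPPORT LENGTH numeral `D`: `M(y,x) ≠ 0 ⇒` the transport length `≤ D`), `coord_<letter>_prodCfg_eq` (= `φ_k` of the NODE 00 letter at `prodCfg U₀ η A′` on
  `δ_x ⊗ e_l`).
HONEST FRAMING: NODE 00's DEFINITIONS read along pv27's DEFINITION; inputs are numerals (`K₀`, `R`, the support length `D` — for the kernels of record the block
edge in lattice steps, NODE 00's ∕ def-Y's geometry, NOT computed here); nothing of Bałaban's asserted; N06 ∕ N10 NOT discharged; K1⁷ NOT closed; counts unmoved
(typed 28∕28 · discharged 5∕27); no `sorry`, no new named fact; standard axioms; one finite 𝕋⁴ programme at fixed ε, Bałaban AS PRINTED; the YM mass gap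
(Clay) is NOT proved by any of this — R4 closes the conditional finite-𝕋⁴ rung `BalabanLadder.UV` only; nothing continuum ∕ ℝ⁴ ∕ OS.

References: T. Bałaban, CMP 99 (1985) 389–434 [Balaban1985BackgroundPropagators] (3.12)–(3.13) p.392, (3.14) p.393, (3.19), (3.21), (3.24) pp.393–394, (3.40) p.397, Thm 3.4
p.400, (3.108) p.416; CMP 116 (1988) 1–22 [Balaban1988RG2Cluster] (2.5) p.12, p.15.
────────────────────────────────────────────────────────────────────────────────────────────────────
v1.0.1 (docstring-only; declarations byte-identical): [B9] page locators corrected per the page owner (lit-balaban-r06 g64, 2026-08-28 03:09Z):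
displays (3.12)–(3.13) are p. 392 (p. 393 opens with (3.14)); thirteen cite segments and the header re-paged, nothing else touched.
-/

noncomputable section

namespace Literature.MathematicalPhysics.QuantumFieldTheory.Balaban1983to89.B13OpsYPencilAveraging

open Metric Set Complex
open NormedSpace (exp)
open Literature.MathematicalPhysics.QuantumFieldTheory.Balaban1983to89
open Literature.MathematicalPhysics.QuantumFieldTheory.Balaban1983to89.B9Eq39Adjoint (R R_def prodCfg)
open Literature.MathematicalPhysics.QuantumFieldTheory.Balaban1983to89.B6GlobalChartV1 (PV boxEquiv)
open Literature.MathematicalPhysics.QuantumFieldTheory.Balaban1983to89.B6KLevelCensusIndexV1 (KIdx)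
open Literature.MathematicalPhysics.QuantumFieldTheory.Balaban1983to89.B15DeterminingSets (embIter)
open Literature.MathematicalPhysics.QuantumFieldTheory.Balaban1983to89.Node00
  (SiteY FBondY IBondY BlkY CfgY qK qsK qpK qpsK qT qpT QY QsY QpY QpsY parBY parSY parTaxiV blkCornerY trLiftY)
open Literature.MathematicalPhysics.QuantumFieldTheory.Balaban1983to89.B13TransportedLiftLetters
  (differentiableOn_coord_trLift coord_trLift_eq_coord_trLiftY)
open Literature.MathematicalPhysics.QuantumFieldTheory.Balaban1983to89.B13OpsYPencilTransport
  (differentiableOn_parTaxiV_prodCfg differentiableOn_parTaxiV_inv_prodCfg norm_parTaxiV_prodCfg_le norm_parTaxiV_inv_prodCfg_le)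

variable {𝔸 : Type} [NormedRing 𝔸] [NormedAlgebra ℂ 𝔸] [CompleteSpace 𝔸]

/-! ## §1. The coordinate bound with transporter bounds asked on the kernel's support only (generic) -/

section Generic

variable {X Y : Type} {κ : Type}
variable {E : Type*} [NormedAddCommGroup E] [NormedSpace ℂ E]
variable (M : Matrix Y X ℝ) (T : E → Y → X → 𝔸ˣ) (φ : κ → 𝔸 →L[ℂ] ℂ) (e : κ → 𝔸) {Rc Kf Kb : ℝ}

omit [CompleteSpace 𝔸] [NormedSpace ℂ E] in
/-- **THE BOUND OF A COORDINATE, TRANSPORTER BOUNDS ON THE SUPPORT**: `‖T(u)(y,x)‖ ≤ Kf`, `‖T(u)(y,x)⁻¹‖ ≤ Kb` wherever `M(y,x) ≠ 0` ⟹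
`‖M(y,x)·φ_k(R(T(u)(y,x)) e_l)‖ ≤ |M(y,x)|·‖φ_k‖·(Kf·‖e_l‖·Kb)` (where `M(y,x) = 0` both sides vanish) — the form the CONTOUR-transported averaging letters need
(print's `x ∈ B^j(y)`: the transport length is the block's, not the torus's). [cite: Balaban1985BackgroundPropagators, (3.19) p.393, Thm 3.4 p.400, (3.108) p.416] -/
theorem norm_coord_trLift_le_of_support (hK0 : 0 ≤ Kf)
    (hKf : ∀ u ∈ ball (0 : E) Rc, ∀ y x, M y x ≠ 0 → ‖(T u y x : 𝔸)‖ ≤ Kf)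
    (hKb : ∀ u ∈ ball (0 : E) Rc, ∀ y x, M y x ≠ 0 → ‖(((T u y x)⁻¹ : 𝔸ˣ) : 𝔸)‖ ≤ Kb)
    {u : E} (hu : u ∈ ball (0 : E) Rc) (y : Y) (x : X) (k l : κ) :
    ‖((M y x : ℝ) : ℂ) * φ k (R (T u y x) (e l))‖ ≤ |M y x| * (‖φ k‖ * (Kf * ‖e l‖ * Kb)) := by
  by_cases hM : M y x = 0
  · rw [hM, Complex.ofReal_zero, zero_mul, norm_zero, abs_zero, zero_mul]
  rw [norm_mul, Complex.norm_real, Real.norm_eq_abs]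
  refine mul_le_mul_of_nonneg_left ?_ (abs_nonneg _)
  refine ((φ k).le_opNorm _).trans (mul_le_mul_of_nonneg_left ?_ (norm_nonneg _))
  have hf := hKf u hu y x hM
  have hb := hKb u hu y x hM
  rw [R_def]
  calc ‖(T u y x : 𝔸) * e l * (((T u y x)⁻¹ : 𝔸ˣ) : 𝔸)‖
      ≤ ‖(T u y x : 𝔸) * e l‖ * ‖(((T u y x)⁻¹ : 𝔸ˣ) : 𝔸)‖ := norm_mul_le _ _
    _ ≤ Kf * ‖e l‖ * Kb :=
        mul_le_mul ((norm_mul_le _ _).trans (mul_le_mul_of_nonneg_right hf (norm_nonneg _))) hb (norm_nonneg _)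
          (mul_nonneg hK0 (norm_nonneg _))

end Generic

/-! ## §2. The averaging assignments `qT ∕ qpT` at the transporter letters of record, along the pencil -/

section Assignments

variable {d ℓ : ℕ} {hd : 1 ≤ d + 1} {hL : Odd (ℓ + 1) ∧ 1 < ℓ + 1} {b₀ b₁ : ℝ}
variable (i : KIdx d ℓ hd hL b₀ b₁) (U₀ : CfgY 𝔸 i) (η : ℝ) {Rc K₀ : ℝ}

/-- At the letters of record the bond-averaging assignment IS the taxicab transporter from the coarse bond's corner to the fine bond's source.
[cite: Balaban1985BackgroundPropagators, (3.12)–(3.13) p.392, (3.14) p.393, (3.40) p.397] -/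
theorem qT_parBY (U : CfgY 𝔸 i) (ι : IBondY i) (b : FBondY i) :
    qT i (parBY i) U ι b = parTaxiV U (embIter (ι.1.1 : ℕ) ι.1.2.src) b.src := rfl

/-- At the letters of record the block-averaging assignment IS the taxicab transporter from the block's corner to the site (through the box chart).
[cite: Balaban1985BackgroundPropagators, (3.19), (3.21) pp.393–394, (3.40) p.397] -/
theorem qpT_parSY (U : CfgY 𝔸 i) (s : BlkY i) (z : SiteY i) :
    qpT i (parSY i) U s z = parTaxiV U ((boxEquiv i.hN).symm (blkCornerY i s)) ((boxEquiv i.hN).symm z) := rfl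

/-- `A′ ↦ qT i parBY (e^{iηA′}U₀) ι b` is holomorphic on every ball. [cite: Balaban1985BackgroundPropagators, (3.12) p.392, Thm 3.4 p.400] -/
theorem differentiableOn_qT_prodCfg (ι : IBondY i) (b : FBondY i) :
    DifferentiableOn ℂ (fun a => (qT i (parBY i) (prodCfg U₀ η a) ι b : 𝔸)) (ball (0 : Fin (d + 1) → Site (PV d ℓ i.m i.K hd hL) 0 → 𝔸) Rc) :=
  differentiableOn_parTaxiV_prodCfg U₀ η _ _

/-- … and its inverse. [cite: Balaban1985BackgroundPropagators, (3.13) p.392, Thm 3.4 p.400] -/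
theorem differentiableOn_qT_inv_prodCfg (ι : IBondY i) (b : FBondY i) :
    DifferentiableOn ℂ (fun a => (((qT i (parBY i) (prodCfg U₀ η a) ι b)⁻¹ : 𝔸ˣ) : 𝔸))
      (ball (0 : Fin (d + 1) → Site (PV d ℓ i.m i.K hd hL) 0 → 𝔸) Rc) :=
  differentiableOn_parTaxiV_inv_prodCfg U₀ η _ _

/-- `A′ ↦ qpT i parSY (e^{iηA′}U₀) s z` is holomorphic on every ball. [cite: Balaban1985BackgroundPropagators, (3.19), (3.21) pp.393–394, Thm 3.4 p.400] -/
theorem differentiableOn_qpT_prodCfg (s : BlkY i) (z : SiteY i) :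
    DifferentiableOn ℂ (fun a => (qpT i (parSY i) (prodCfg U₀ η a) s z : 𝔸)) (ball (0 : Fin (d + 1) → Site (PV d ℓ i.m i.K hd hL) 0 → 𝔸) Rc) :=
  differentiableOn_parTaxiV_prodCfg U₀ η _ _

/-- … and its inverse. [cite: Balaban1985BackgroundPropagators, (3.24) p.394, Thm 3.4 p.400] -/
theorem differentiableOn_qpT_inv_prodCfg (s : BlkY i) (z : SiteY i) :
    DifferentiableOn ℂ (fun a => (((qpT i (parSY i) (prodCfg U₀ η a) s z)⁻¹ : 𝔸ˣ) : 𝔸))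
      (ball (0 : Fin (d + 1) → Site (PV d ℓ i.m i.K hd hL) 0 → 𝔸) Rc) :=
  differentiableOn_parTaxiV_inv_prodCfg U₀ η _ _

variable [NormOneClass 𝔸]

/-- On `‖A′‖ < R`: `‖qT i parBY (e^{iηA′}U₀) ι b‖ ≤ Kη^{tdist(corner ι, b.src)}`. [cite: Balaban1985BackgroundPropagators, (3.12) p.392, (3.40) p.397] -/
theorem norm_qT_prodCfg_le (hU : ∀ μ x, ‖(U₀ μ x : 𝔸)‖ ≤ K₀) (hUi : ∀ μ x, ‖(((U₀ μ x)⁻¹ : 𝔸ˣ) : 𝔸)‖ ≤ K₀) (hRc : 0 ≤ Rc)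
    {a : Fin (d + 1) → Site (PV d ℓ i.m i.K hd hL) 0 → 𝔸} (ha : a ∈ ball 0 Rc) (ι : IBondY i) (b : FBondY i) :
    ‖(qT i (parBY i) (prodCfg U₀ η a) ι b : 𝔸)‖ ≤ (K₀ * Real.exp (|η| * Rc)) ^ Site.tdist (embIter (ι.1.1 : ℕ) ι.1.2.src) b.src :=
  norm_parTaxiV_prodCfg_le U₀ η hU hUi hRc ha _ _

/-- … and `‖(qT …)⁻¹‖ ≤ Kη^{tdist(corner ι, b.src)}`. [cite: Balaban1985BackgroundPropagators, (3.13) p.392, (3.40) p.397] -/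
theorem norm_qT_inv_prodCfg_le (hU : ∀ μ x, ‖(U₀ μ x : 𝔸)‖ ≤ K₀) (hUi : ∀ μ x, ‖(((U₀ μ x)⁻¹ : 𝔸ˣ) : 𝔸)‖ ≤ K₀) (hRc : 0 ≤ Rc)
    {a : Fin (d + 1) → Site (PV d ℓ i.m i.K hd hL) 0 → 𝔸} (ha : a ∈ ball 0 Rc) (ι : IBondY i) (b : FBondY i) :
    ‖(((qT i (parBY i) (prodCfg U₀ η a) ι b)⁻¹ : 𝔸ˣ) : 𝔸)‖ ≤ (K₀ * Real.exp (|η| * Rc)) ^ Site.tdist (embIter (ι.1.1 : ℕ) ι.1.2.src) b.src :=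
  norm_parTaxiV_inv_prodCfg_le U₀ η hU hUi hRc ha _ _

/-- On `‖A′‖ < R`: `‖qpT i parSY (e^{iηA′}U₀) s z‖ ≤ Kη^{tdist(chart⁻¹(corner s), chart⁻¹ z)}`. [cite: Balaban1985BackgroundPropagators, (3.19), (3.21) pp.393–394, (3.40) p.397] -/
theorem norm_qpT_prodCfg_le (hU : ∀ μ x, ‖(U₀ μ x : 𝔸)‖ ≤ K₀) (hUi : ∀ μ x, ‖(((U₀ μ x)⁻¹ : 𝔸ˣ) : 𝔸)‖ ≤ K₀) (hRc : 0 ≤ Rc)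
    {a : Fin (d + 1) → Site (PV d ℓ i.m i.K hd hL) 0 → 𝔸} (ha : a ∈ ball 0 Rc) (s : BlkY i) (z : SiteY i) :
    ‖(qpT i (parSY i) (prodCfg U₀ η a) s z : 𝔸)‖ ≤
      (K₀ * Real.exp (|η| * Rc)) ^ Site.tdist ((boxEquiv i.hN).symm (blkCornerY i s)) ((boxEquiv i.hN).symm z) :=
  norm_parTaxiV_prodCfg_le U₀ η hU hUi hRc ha _ _

/-- … and `‖(qpT …)⁻¹‖ ≤` the same. [cite: Balaban1985BackgroundPropagators, (3.24) p.394, (3.40) p.397] -/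
theorem norm_qpT_inv_prodCfg_le (hU : ∀ μ x, ‖(U₀ μ x : 𝔸)‖ ≤ K₀) (hUi : ∀ μ x, ‖(((U₀ μ x)⁻¹ : 𝔸ˣ) : 𝔸)‖ ≤ K₀) (hRc : 0 ≤ Rc)
    {a : Fin (d + 1) → Site (PV d ℓ i.m i.K hd hL) 0 → 𝔸} (ha : a ∈ ball 0 Rc) (s : BlkY i) (z : SiteY i) :
    ‖(((qpT i (parSY i) (prodCfg U₀ η a) s z)⁻¹ : 𝔸ˣ) : 𝔸)‖ ≤
      (K₀ * Real.exp (|η| * Rc)) ^ Site.tdist ((boxEquiv i.hN).symm (blkCornerY i s)) ((boxEquiv i.hN).symm z) :=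
  norm_parTaxiV_inv_prodCfg_le U₀ η hU hUi hRc ha _ _

end Assignments

/-! ## §3. ★ The four averaging letters' coordinates along the pencil -/

section Coordinates

variable {d ℓ : ℕ} {hd : 1 ≤ d + 1} {hL : Odd (ℓ + 1) ∧ 1 < ℓ + 1} {b₀ b₁ : ℝ}
variable (i : KIdx d ℓ hd hL b₀ b₁) (U₀ : CfgY 𝔸 i) (η : ℝ) {κ : Type} (φ : κ → 𝔸 →L[ℂ] ℂ) (e : κ → 𝔸) {Rc K₀ : ℝ} {D : ℕ}

/-- ★ **`Q(U)` (3.12) ALONG THE PENCIL — HOLOMORPHY**: every coordinate `A′ ↦ qK(ι,b)·φ_k(R(qT i parBY (e^{iηA′}U₀) ι b) e_l)` of NODE 00's covariant bond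
averaging is holomorphic on every chart ball. [cite: Balaban1985BackgroundPropagators, (3.12) p.392, Thm 3.4 p.400] -/
theorem differentiableOn_coord_QY_prodCfg (ι : IBondY i) (b : FBondY i) (k l : κ) :
    DifferentiableOn ℂ (fun a => ((qK i ι b : ℝ) : ℂ) * φ k (R (qT i (parBY i) (prodCfg U₀ η a) ι b) (e l)))
      (ball (0 : Fin (d + 1) → Site (PV d ℓ i.m i.K hd hL) 0 → 𝔸) Rc) :=
  differentiableOn_coord_trLift (qK i) (fun a => qT i (parBY i) (prodCfg U₀ η a)) φ e
    (differentiableOn_qT_prodCfg i U₀ η) (differentiableOn_qT_inv_prodCfg i U₀ η) ι b k l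

/-- ★ **`Q(U)` (3.12) ALONG THE PENCIL — IDENTIFICATION** with `φ_k` of NODE 00's `QY i parBY (prodCfg U₀ η A′)` on `δ_b ⊗ e_l`, read at `ι`.
[cite: Balaban1985BackgroundPropagators, (3.12) p.392] -/
theorem coord_QY_prodCfg_eq [DecidableEq (FBondY i)] (a : Fin (d + 1) → Site (PV d ℓ i.m i.K hd hL) 0 → 𝔸) (ι : IBondY i) (b : FBondY i) (k l : κ) :
    ((qK i ι b : ℝ) : ℂ) * φ k (R (qT i (parBY i) (prodCfg U₀ η a) ι b) (e l)) =
      φ k (QY i (parBY i) (prodCfg U₀ η a) (Pi.single b (e l)) ι) :=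
  coord_trLift_eq_coord_trLiftY (qK i) (fun a => qT i (parBY i) (prodCfg U₀ η a)) φ e a ι b k l

/-- ★ **`Q*(U)` (3.13) ALONG THE PENCIL — HOLOMORPHY** (inverted transporters): every coordinate
`A′ ↦ qsK(b,ι)·φ_k(R((qT i parBY (e^{iηA′}U₀) ι b)⁻¹) e_l)` is holomorphic on every chart ball. [cite: Balaban1985BackgroundPropagators, (3.13) p.392, Thm 3.4 p.400] -/
theorem differentiableOn_coord_QsY_prodCfg (b : FBondY i) (ι : IBondY i) (k l : κ) :
    DifferentiableOn ℂ (fun a => ((qsK i b ι : ℝ) : ℂ) * φ k (R ((qT i (parBY i) (prodCfg U₀ η a) ι b)⁻¹) (e l)))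
      (ball (0 : Fin (d + 1) → Site (PV d ℓ i.m i.K hd hL) 0 → 𝔸) Rc) := by
  refine differentiableOn_coord_trLift (qsK i) (fun a b ι => (qT i (parBY i) (prodCfg U₀ η a) ι b)⁻¹) φ e
    (fun b ι => differentiableOn_qT_inv_prodCfg i U₀ η ι b) (fun b ι => ?_) b ι k l
  simpa only [inv_inv] using differentiableOn_qT_prodCfg i U₀ η (Rc := Rc) ι b

/-- ★ **`Q*(U)` (3.13) — IDENTIFICATION** with `φ_k` of NODE 00's `QsY i parBY (prodCfg U₀ η A′)` on `δ_ι ⊗ e_l`, read at `b`.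
[cite: Balaban1985BackgroundPropagators, (3.13) p.392] -/
theorem coord_QsY_prodCfg_eq [DecidableEq (IBondY i)] (a : Fin (d + 1) → Site (PV d ℓ i.m i.K hd hL) 0 → 𝔸) (b : FBondY i) (ι : IBondY i)
    (k l : κ) :
    ((qsK i b ι : ℝ) : ℂ) * φ k (R ((qT i (parBY i) (prodCfg U₀ η a) ι b)⁻¹) (e l)) =
      φ k (QsY i (parBY i) (prodCfg U₀ η a) (Pi.single ι (e l)) b) :=
  coord_trLift_eq_coord_trLiftY (qsK i) (fun a b ι => (qT i (parBY i) (prodCfg U₀ η a) ι b)⁻¹) φ e a b ι k l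

/-- ★ **`Q′(U)` (3.19)∕(3.21) ALONG THE PENCIL — HOLOMORPHY**: every coordinate `A′ ↦ qpK(s,z)·φ_k(R(qpT i parSY (e^{iηA′}U₀) s z) e_l)` of NODE 00's
covariant block averaging is holomorphic on every chart ball. [cite: Balaban1985BackgroundPropagators, (3.19), (3.21) pp.393–394, Thm 3.4 p.400] -/
theorem differentiableOn_coord_QpY_prodCfg (s : BlkY i) (z : SiteY i) (k l : κ) :
    DifferentiableOn ℂ (fun a => ((qpK i s z : ℝ) : ℂ) * φ k (R (qpT i (parSY i) (prodCfg U₀ η a) s z) (e l)))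
      (ball (0 : Fin (d + 1) → Site (PV d ℓ i.m i.K hd hL) 0 → 𝔸) Rc) :=
  differentiableOn_coord_trLift (qpK i) (fun a => qpT i (parSY i) (prodCfg U₀ η a)) φ e
    (differentiableOn_qpT_prodCfg i U₀ η) (differentiableOn_qpT_inv_prodCfg i U₀ η) s z k l

/-- ★ **`Q′(U)` — IDENTIFICATION** with `φ_k` of NODE 00's `QpY i parSY (prodCfg U₀ η A′)` on `δ_z ⊗ e_l`, read at the block `s`.
[cite: Balaban1985BackgroundPropagators, (3.19), (3.21) pp.393–394] -/
theorem coord_QpY_prodCfg_eq [DecidableEq (SiteY i)] (a : Fin (d + 1) → Site (PV d ℓ i.m i.K hd hL) 0 → 𝔸) (s : BlkY i) (z : SiteY i) (k l : κ) :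
    ((qpK i s z : ℝ) : ℂ) * φ k (R (qpT i (parSY i) (prodCfg U₀ η a) s z) (e l)) =
      φ k (QpY i (parSY i) (prodCfg U₀ η a) (Pi.single z (e l)) s) :=
  coord_trLift_eq_coord_trLiftY (qpK i) (fun a => qpT i (parSY i) (prodCfg U₀ η a)) φ e a s z k l

/-- ★ **`Q′*(U)` (3.24) ALONG THE PENCIL — HOLOMORPHY** (inverted transporters): every coordinate
`A′ ↦ qpsK(z,s)·φ_k(R((qpT i parSY (e^{iηA′}U₀) s z)⁻¹) e_l)` is holomorphic on every chart ball. [cite: Balaban1985BackgroundPropagators, (3.24) p.394, Thm 3.4 p.400] -/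
theorem differentiableOn_coord_QpsY_prodCfg (z : SiteY i) (s : BlkY i) (k l : κ) :
    DifferentiableOn ℂ (fun a => ((qpsK i z s : ℝ) : ℂ) * φ k (R ((qpT i (parSY i) (prodCfg U₀ η a) s z)⁻¹) (e l)))
      (ball (0 : Fin (d + 1) → Site (PV d ℓ i.m i.K hd hL) 0 → 𝔸) Rc) := by
  refine differentiableOn_coord_trLift (qpsK i) (fun a z s => (qpT i (parSY i) (prodCfg U₀ η a) s z)⁻¹) φ e
    (fun z s => differentiableOn_qpT_inv_prodCfg i U₀ η s z) (fun z s => ?_) z s k l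
  simpa only [inv_inv] using differentiableOn_qpT_prodCfg i U₀ η (Rc := Rc) s z

/-- ★ **`Q′*(U)` — IDENTIFICATION** with `φ_k` of NODE 00's `QpsY i parSY (prodCfg U₀ η A′)` on `δ_s ⊗ e_l`, read at the site `z`.
[cite: Balaban1985BackgroundPropagators, (3.24) p.394] -/
theorem coord_QpsY_prodCfg_eq [DecidableEq (BlkY i)] (a : Fin (d + 1) → Site (PV d ℓ i.m i.K hd hL) 0 → 𝔸) (z : SiteY i) (s : BlkY i) (k l : κ) :
    ((qpsK i z s : ℝ) : ℂ) * φ k (R ((qpT i (parSY i) (prodCfg U₀ η a) s z)⁻¹) (e l)) =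
      φ k (QpsY i (parSY i) (prodCfg U₀ η a) (Pi.single s (e l)) z) :=
  coord_trLift_eq_coord_trLiftY (qpsK i) (fun a z s => (qpT i (parSY i) (prodCfg U₀ η a) s z)⁻¹) φ e a z s k l

variable [NormOneClass 𝔸]

omit [CompleteSpace 𝔸] in
/-- `Kηⁿ ≤ Kη^D` for `n ≤ D`, `1 ≤ Kη` (plumbing). [folklore] -/
private theorem pow_le_pow_of_le_D {K : ℝ} (hK : 1 ≤ K) {n D : ℕ} (h : n ≤ D) : K ^ n ≤ K ^ D := pow_le_pow_right₀ hK h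

/-- ★ **`Q(U)` (3.12) ALONG THE PENCIL — BOUND** on `‖A′‖ < R`: `≤ |qK(ι,b)|·‖φ_k‖·(Kη^D·‖e_l‖·Kη^D)` given the SUPPORT LENGTH numeral `D`
(`qK(ι,b) ≠ 0 ⇒ tdist(corner ι, b.src) ≤ D`: the fine bond lies in the coarse bond's block) and `‖U₀(b)^{±1}‖ ≤ K₀`, `1 ≤ K₀`.
[cite: Balaban1985BackgroundPropagators, (3.12) p.392, (3.40) p.397, Thm 3.4 p.400, (3.108) p.416] -/
theorem norm_coord_QY_prodCfg_le (hU : ∀ μ x, ‖(U₀ μ x : 𝔸)‖ ≤ K₀) (hUi : ∀ μ x, ‖(((U₀ μ x)⁻¹ : 𝔸ˣ) : 𝔸)‖ ≤ K₀) (hK1 : 1 ≤ K₀)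
    (hRc : 0 ≤ Rc) (hD : ∀ ι b, qK i ι b ≠ 0 → Site.tdist (embIter (ι.1.1 : ℕ) ι.1.2.src) b.src ≤ D)
    {a : Fin (d + 1) → Site (PV d ℓ i.m i.K hd hL) 0 → 𝔸} (ha : a ∈ ball 0 Rc) (ι : IBondY i) (b : FBondY i) (k l : κ) :
    ‖((qK i ι b : ℝ) : ℂ) * φ k (R (qT i (parBY i) (prodCfg U₀ η a) ι b) (e l))‖ ≤
      |qK i ι b| * (‖φ k‖ * ((K₀ * Real.exp (|η| * Rc)) ^ D * ‖e l‖ * (K₀ * Real.exp (|η| * Rc)) ^ D)) := by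
  have h1 : (1 : ℝ) ≤ K₀ * Real.exp (|η| * Rc) :=
    one_le_mul_of_one_le_of_one_le hK1 (Real.one_le_exp (mul_nonneg (abs_nonneg _) hRc))
  have h0 : (0 : ℝ) ≤ (K₀ * Real.exp (|η| * Rc)) ^ D := pow_nonneg (zero_le_one.trans h1) D
  exact norm_coord_trLift_le_of_support (qK i) (fun a => qT i (parBY i) (prodCfg U₀ η a)) φ e h0
    (fun a ha ι b hM => (norm_qT_prodCfg_le i U₀ η hU hUi hRc ha ι b).trans (pow_le_pow_of_le_D h1 (hD ι b hM)))
    (fun a ha ι b hM => (norm_qT_inv_prodCfg_le i U₀ η hU hUi hRc ha ι b).trans (pow_le_pow_of_le_D h1 (hD ι b hM))) ha ι b k l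

/-- ★ **`Q*(U)` (3.13) ALONG THE PENCIL — BOUND**: `≤ |qsK(b,ι)|·‖φ_k‖·(Kη^D·‖e_l‖·Kη^D)` given `qsK(b,ι) ≠ 0 ⇒ tdist(corner ι, b.src) ≤ D`.
[cite: Balaban1985BackgroundPropagators, (3.13) p.392, (3.40) p.397, Thm 3.4 p.400, (3.108) p.416] -/
theorem norm_coord_QsY_prodCfg_le (hU : ∀ μ x, ‖(U₀ μ x : 𝔸)‖ ≤ K₀) (hUi : ∀ μ x, ‖(((U₀ μ x)⁻¹ : 𝔸ˣ) : 𝔸)‖ ≤ K₀) (hK1 : 1 ≤ K₀)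
    (hRc : 0 ≤ Rc) (hD : ∀ b ι, qsK i b ι ≠ 0 → Site.tdist (embIter (ι.1.1 : ℕ) ι.1.2.src) b.src ≤ D)
    {a : Fin (d + 1) → Site (PV d ℓ i.m i.K hd hL) 0 → 𝔸} (ha : a ∈ ball 0 Rc) (b : FBondY i) (ι : IBondY i) (k l : κ) :
    ‖((qsK i b ι : ℝ) : ℂ) * φ k (R ((qT i (parBY i) (prodCfg U₀ η a) ι b)⁻¹) (e l))‖ ≤
      |qsK i b ι| * (‖φ k‖ * ((K₀ * Real.exp (|η| * Rc)) ^ D * ‖e l‖ * (K₀ * Real.exp (|η| * Rc)) ^ D)) := by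
  have h1 : (1 : ℝ) ≤ K₀ * Real.exp (|η| * Rc) :=
    one_le_mul_of_one_le_of_one_le hK1 (Real.one_le_exp (mul_nonneg (abs_nonneg _) hRc))
  have h0 : (0 : ℝ) ≤ (K₀ * Real.exp (|η| * Rc)) ^ D := pow_nonneg (zero_le_one.trans h1) D
  refine norm_coord_trLift_le_of_support (qsK i) (fun a b ι => (qT i (parBY i) (prodCfg U₀ η a) ι b)⁻¹) φ e h0
    (fun a ha b ι hM => (norm_qT_inv_prodCfg_le i U₀ η hU hUi hRc ha ι b).trans (pow_le_pow_of_le_D h1 (hD b ι hM)))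
    (fun a ha b ι hM => ?_) ha b ι k l
  rw [inv_inv]
  exact (norm_qT_prodCfg_le i U₀ η hU hUi hRc ha ι b).trans (pow_le_pow_of_le_D h1 (hD b ι hM))

/-- ★ **`Q′(U)` (3.19)∕(3.21) ALONG THE PENCIL — BOUND**: `≤ |qpK(s,z)|·‖φ_k‖·(Kη^D·‖e_l‖·Kη^D)` given `qpK(s,z) ≠ 0 ⇒ tdist(chart⁻¹(corner s), chart⁻¹ z) ≤ D`
(print's `x ∈ B^j(y)`). [cite: Balaban1985BackgroundPropagators, (3.19), (3.21) pp.393–394, (3.40) p.397, Thm 3.4 p.400, (3.108) p.416] -/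
theorem norm_coord_QpY_prodCfg_le (hU : ∀ μ x, ‖(U₀ μ x : 𝔸)‖ ≤ K₀) (hUi : ∀ μ x, ‖(((U₀ μ x)⁻¹ : 𝔸ˣ) : 𝔸)‖ ≤ K₀) (hK1 : 1 ≤ K₀)
    (hRc : 0 ≤ Rc)
    (hD : ∀ s z, qpK i s z ≠ 0 → Site.tdist ((boxEquiv i.hN).symm (blkCornerY i s)) ((boxEquiv i.hN).symm z) ≤ D)
    {a : Fin (d + 1) → Site (PV d ℓ i.m i.K hd hL) 0 → 𝔸} (ha : a ∈ ball 0 Rc) (s : BlkY i) (z : SiteY i) (k l : κ) :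
    ‖((qpK i s z : ℝ) : ℂ) * φ k (R (qpT i (parSY i) (prodCfg U₀ η a) s z) (e l))‖ ≤
      |qpK i s z| * (‖φ k‖ * ((K₀ * Real.exp (|η| * Rc)) ^ D * ‖e l‖ * (K₀ * Real.exp (|η| * Rc)) ^ D)) := by
  have h1 : (1 : ℝ) ≤ K₀ * Real.exp (|η| * Rc) :=
    one_le_mul_of_one_le_of_one_le hK1 (Real.one_le_exp (mul_nonneg (abs_nonneg _) hRc))
  have h0 : (0 : ℝ) ≤ (K₀ * Real.exp (|η| * Rc)) ^ D := pow_nonneg (zero_le_one.trans h1) D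
  exact norm_coord_trLift_le_of_support (qpK i) (fun a => qpT i (parSY i) (prodCfg U₀ η a)) φ e h0
    (fun a ha s z hM => (norm_qpT_prodCfg_le i U₀ η hU hUi hRc ha s z).trans (pow_le_pow_of_le_D h1 (hD s z hM)))
    (fun a ha s z hM => (norm_qpT_inv_prodCfg_le i U₀ η hU hUi hRc ha s z).trans (pow_le_pow_of_le_D h1 (hD s z hM))) ha s z k l

/-- ★ **`Q′*(U)` (3.24) ALONG THE PENCIL — BOUND**: `≤ |qpsK(z,s)|·‖φ_k‖·(Kη^D·‖e_l‖·Kη^D)` given `qpsK(z,s) ≠ 0 ⇒ tdist(chart⁻¹(corner s), chart⁻¹ z) ≤ D`.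
[cite: Balaban1985BackgroundPropagators, (3.24) p.394, (3.40) p.397, Thm 3.4 p.400, (3.108) p.416] -/
theorem norm_coord_QpsY_prodCfg_le (hU : ∀ μ x, ‖(U₀ μ x : 𝔸)‖ ≤ K₀) (hUi : ∀ μ x, ‖(((U₀ μ x)⁻¹ : 𝔸ˣ) : 𝔸)‖ ≤ K₀) (hK1 : 1 ≤ K₀)
    (hRc : 0 ≤ Rc)
    (hD : ∀ z s, qpsK i z s ≠ 0 → Site.tdist ((boxEquiv i.hN).symm (blkCornerY i s)) ((boxEquiv i.hN).symm z) ≤ D)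
    {a : Fin (d + 1) → Site (PV d ℓ i.m i.K hd hL) 0 → 𝔸} (ha : a ∈ ball 0 Rc) (z : SiteY i) (s : BlkY i) (k l : κ) :
    ‖((qpsK i z s : ℝ) : ℂ) * φ k (R ((qpT i (parSY i) (prodCfg U₀ η a) s z)⁻¹) (e l))‖ ≤
      |qpsK i z s| * (‖φ k‖ * ((K₀ * Real.exp (|η| * Rc)) ^ D * ‖e l‖ * (K₀ * Real.exp (|η| * Rc)) ^ D)) := by
  have h1 : (1 : ℝ) ≤ K₀ * Real.exp (|η| * Rc) :=
    one_le_mul_of_one_le_of_one_le hK1 (Real.one_le_exp (mul_nonneg (abs_nonneg _) hRc))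
  have h0 : (0 : ℝ) ≤ (K₀ * Real.exp (|η| * Rc)) ^ D := pow_nonneg (zero_le_one.trans h1) D
  refine norm_coord_trLift_le_of_support (qpsK i) (fun a z s => (qpT i (parSY i) (prodCfg U₀ η a) s z)⁻¹) φ e h0
    (fun a ha z s hM => (norm_qpT_inv_prodCfg_le i U₀ η hU hUi hRc ha s z).trans (pow_le_pow_of_le_D h1 (hD z s hM)))
    (fun a ha z s hM => ?_) ha z s k l
  rw [inv_inv]
  exact (norm_qpT_prodCfg_le i U₀ η hU hUi hRc ha s z).trans (pow_le_pow_of_le_D h1 (hD z s hM))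

end Coordinates

end Literature.MathematicalPhysics.QuantumFieldTheory.Balaban1983to89.B13OpsYPencilAveraging

end
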